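import Summits.RiemannHypothesis.RiemannHypothesis.Theorems.SpectralTraceWindowTraceArchStubSmearedWindowFormula
import HarnessLib

/-!
# Integrability of the smeared window integrand (`stub_smearedIntegrable`)

Stub `stub_smearedIntegrable` of the line `causal-level-sets` for the crux `WindowTraceArch`
(stmt-RiemannHypothesis-11195; skeleton
`Summit.RiemannHypothesis.RiemannHypothesis.Cruxes.WindowTraceArch.CausalLevelSets`).

**Statement.** Let `γ, b : ℕ → ℝ` be a configuration with widths `δ ≤ b k ≤ B` (`δ > 0`) and
`Σ_k 1/(1 + γ_k²) < ∞`, let `c` be any real number and `g` a Weil test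
(`Literature.NumberTheory.LFunctions.IsWeilTest`: smooth of compact support) with transform
`ĝ(s) = weilMellin g s`. Then the integrand of the smeared window formula,
`t ↦ ĝ(1/2 + it) · (c + Σ_k b_k/((t - γ_k)² + b_k²))`,
is Lebesgue integrable on `ℝ`.

**Proof.** Split `ĝ · (c + S) = c ĝ + ĝ S` with `S(t) = Σ_k b_k/((t - γ_k)² + b_k²)`.
* The `c`-part: `t ↦ ĝ(1/2 + it)` is integrable (`integrable_weilMellin_vertical`).
* The series part: Peetre's inequality gives
  `b_k/((t - γ_k)² + b_k²) ≤ 2B(1 + δ⁻²)(1 + t²)/(1 + γ_k²)` (`stub_smearedWindowFormula_poisson_le`),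
  so the kernels are summable for each `t` with `0 ≤ S(t) ≤ C₀ (1 + t²) Σ_k 1/(1 + γ_k²)`;
  the decay `(1 + t²)‖ĝ(1/2 + it)‖ ≤ C₁/(1 + t²)` (`stub_smearedWindowFormula_decay`, two
  integrations by parts) bounds `‖ĝ S‖` by the integrable majorant
  `C₀ C₁ (Σ_k 1/(1 + γ_k²)) (1 + t²)⁻¹` (`integrable_inv_one_add_sq`). Measurability of `S` is that
  of a pointwise limit of finite sums of continuous functions; conclude with `Integrable.mono'`.

**Sources.** Standard real analysis (dominated comparison, Peetre's inequality); all ingredients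
are proved tree / Mathlib facts (the sibling stub `stub_smearedWindowFormula` and its helpers).
-/

set_option linter.dupNamespace false

noncomputable section

open Complex Set MeasureTheory Filter
open scoped Real Topology

namespace Summit.RiemannHypothesis.RiemannHypothesis.Theorems.SpectralTraceWindowTraceArch

open Literature.NumberTheory.LFunctions

/-- **stub_smearedIntegrable — integrability bookkeeping.** For a configuration `(γ_k, b_k)` with
`δ ≤ b_k ≤ B` (`δ > 0`), `Σ_k 1/(1+γ_k²) < ∞`, any real `c` and any Weil test `g`, the integrand
`ĝ(1/2+it) · (c + Σ_k b_k/((t−γ_k)²+b_k²))` of the smeared window formula is Lebesgue integrable: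
the `c`-part by `integrable_weilMellin_vertical`, the series part by the Peetre bound
`stub_smearedWindowFormula_poisson_le` and the decay `stub_smearedWindowFormula_decay`, dominated by
`const · (1 + t²)⁻¹`. -/
theorem stub_smearedIntegrable :
    ∀ (γ b : ℕ → ℝ) (δ B c : ℝ), 0 < δ → (∀ k, δ ≤ b k ∧ b k ≤ B) →
      Summable (fun k => 1 / (1 + (γ k) ^ 2)) →
      ∀ g : ℝ → ℂ, IsWeilTest g →
        Integrable (fun t : ℝ => weilMellin g (1 / 2 + (t : ℂ) * I) *
          (((c + ∑' k, b k / ((t - γ k) ^ 2 + (b k) ^ 2) : ℝ)) : ℂ)) := by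
  intro γ b δ B c hδ hb hγ g hg
  have hbpos : ∀ k, 0 < b k := fun k => hδ.trans_le (hb k).1
  have hB : 0 ≤ B := (hbpos 0).le.trans (hb 0).2
  have hS₀ : 0 ≤ ∑' k, 1 / (1 + (γ k) ^ 2) := tsum_nonneg fun k => by positivity
  -- pointwise bounds on the Poisson kernels `P_k(t) = b_k / ((t - γ_k)² + b_k²)`
  have hP0 : ∀ k t, 0 ≤ b k / ((t - γ k) ^ 2 + (b k) ^ 2) := fun k t =>
    stub_smearedWindowFormula_poisson_nonneg (hbpos k).le t (γ k)
  have hPc : ∀ k, Continuous fun t : ℝ => b k / ((t - γ k) ^ 2 + (b k) ^ 2) := fun k =>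
    continuous_const.div (by fun_prop) fun t => by have := hbpos k; positivity
  obtain ⟨C₀, hC₀, hPle⟩ : ∃ C₀ : ℝ, 0 ≤ C₀ ∧ ∀ k t,
      b k / ((t - γ k) ^ 2 + (b k) ^ 2) ≤ C₀ * (1 + t ^ 2) * (1 / (1 + (γ k) ^ 2)) := by
    refine ⟨2 * B * (1 + (δ ^ 2)⁻¹), by positivity, fun k t => ?_⟩
    rw [mul_one_div]
    exact stub_smearedWindowFormula_poisson_le hδ (hb k).1 (hb k).2 t (γ k)
  -- summability in `k` for each `t`, and the bound on the sum
  have hPsum : ∀ t, Summable (fun k => b k / ((t - γ k) ^ 2 + (b k) ^ 2)) := fun t =>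
    Summable.of_nonneg_of_le (hP0 · t) (hPle · t) (hγ.mul_left _)
  have hSt0 : ∀ t, 0 ≤ ∑' k, b k / ((t - γ k) ^ 2 + (b k) ^ 2) := fun t => tsum_nonneg (hP0 · t)
  have hStle : ∀ t, ∑' k, b k / ((t - γ k) ^ 2 + (b k) ^ 2) ≤
      C₀ * (1 + t ^ 2) * ∑' k, 1 / (1 + (γ k) ^ 2) := fun t =>
    calc ∑' k, b k / ((t - γ k) ^ 2 + (b k) ^ 2)
        ≤ ∑' k, C₀ * (1 + t ^ 2) * (1 / (1 + (γ k) ^ 2)) :=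
          (hPsum t).tsum_le_tsum (hPle · t) (hγ.mul_left _)
      _ = C₀ * (1 + t ^ 2) * ∑' k, 1 / (1 + (γ k) ^ 2) := tsum_mul_left
  -- the transform on the critical line: continuity, integrability, decay
  have hFc : Continuous fun t : ℝ => weilMellin g (1 / 2 + (t : ℂ) * I) :=
    (continuous_weilMellin hg.1.continuous hg.2).comp (by fun_prop)
  have hhalf : ((1 / 2 : ℝ) : ℂ) = 1 / 2 := by push_cast; rfl
  have hFi : Integrable fun t : ℝ => weilMellin g (1 / 2 + (t : ℂ) * I) := by
    have := integrable_weilMellin_vertical hg (1 / 2)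
    rwa [hhalf] at this
  obtain ⟨C₁, hFdecay⟩ : ∃ C₁ : ℝ, ∀ t : ℝ,
      (1 + t ^ 2) * ‖weilMellin g (1 / 2 + (t : ℂ) * I)‖ ≤ C₁ / (1 + t ^ 2) :=
    ⟨_, fun t => stub_smearedWindowFormula_decay hg t⟩
  -- the dominating function
  have hdom : Integrable fun t : ℝ => C₀ * C₁ * (∑' k, 1 / (1 + (γ k) ^ 2)) * (1 + t ^ 2)⁻¹ :=
    integrable_inv_one_add_sq.const_mul _
  have hdom_le : ∀ t : ℝ, ‖weilMellin g (1 / 2 + (t : ℂ) * I)‖ *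
      (C₀ * (1 + t ^ 2) * ∑' k, 1 / (1 + (γ k) ^ 2)) ≤
        C₀ * C₁ * (∑' k, 1 / (1 + (γ k) ^ 2)) * (1 + t ^ 2)⁻¹ := by
    intro t
    calc ‖weilMellin g (1 / 2 + (t : ℂ) * I)‖ * (C₀ * (1 + t ^ 2) * ∑' k, 1 / (1 + (γ k) ^ 2))
        = C₀ * (∑' k, 1 / (1 + (γ k) ^ 2)) *
            ((1 + t ^ 2) * ‖weilMellin g (1 / 2 + (t : ℂ) * I)‖) := by ring
      _ ≤ C₀ * (∑' k, 1 / (1 + (γ k) ^ 2)) * (C₁ / (1 + t ^ 2)) :=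
          mul_le_mul_of_nonneg_left (hFdecay t) (mul_nonneg hC₀ hS₀)
      _ = C₀ * C₁ * (∑' k, 1 / (1 + (γ k) ^ 2)) * (1 + t ^ 2)⁻¹ := by ring
  -- measurability of the smeared series: a pointwise limit of finite sums
  have hSm : AEStronglyMeasurable
      (fun t : ℝ => ∑' k, b k / ((t - γ k) ^ 2 + (b k) ^ 2)) volume := by
    refine aestronglyMeasurable_of_tendsto_ae atTop
      (f := fun N t => ∑ k ∈ Finset.range N, b k / ((t - γ k) ^ 2 + (b k) ^ 2))
      (fun N => (continuous_finsetSum _ fun k _ => hPc k).aestronglyMeasurable)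
      (Eventually.of_forall fun t => (hPsum t).hasSum.tendsto_sum_nat)
  -- the series part is integrable by domination
  have hFS : Integrable fun t : ℝ => weilMellin g (1 / 2 + (t : ℂ) * I) *
      (((∑' k, b k / ((t - γ k) ^ 2 + (b k) ^ 2)) : ℝ) : ℂ) := by
    refine hdom.mono'
      (hFc.aestronglyMeasurable.mul (Complex.continuous_ofReal.comp_aestronglyMeasurable hSm))
      (Eventually.of_forall fun t => ?_)
    rw [norm_mul, Complex.norm_real, Real.norm_of_nonneg (hSt0 t)]
    exact (mul_le_mul_of_nonneg_left (hStle t) (norm_nonneg _)).trans (hdom_le t)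
  -- split off the `c`-part
  have e : (fun t : ℝ => weilMellin g (1 / 2 + (t : ℂ) * I) *
      (((c + ∑' k, b k / ((t - γ k) ^ 2 + (b k) ^ 2) : ℝ)) : ℂ)) = fun t : ℝ =>
      (c : ℂ) * weilMellin g (1 / 2 + (t : ℂ) * I) + weilMellin g (1 / 2 + (t : ℂ) * I) *
        (((∑' k, b k / ((t - γ k) ^ 2 + (b k) ^ 2)) : ℝ) : ℂ) := by
    funext t
    rw [Complex.ofReal_add]
    ring
  rw [e]
  exact (hFi.const_mul _).add hFS

end Summit.RiemannHypothesis.RiemannHypothesis.Theorems.SpectralTraceWindowTraceArch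

end
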